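import Summits.QuantumFields.BalabanUV.T4Continuum.Support.SubstrateLargeFieldNested

/-!
# T⁴ programme, SUBSTRATE — `Support/SubstrateLargeFieldNestedSharp` (part 3 of `Support/SubstrateLargeField`): the nested
# decomposition with SHARP cut-offs READ EXACTLY — the only history with a non-zero piece is the OBSERVED one, on which the
# field is small off the recorded large-field sets — and MEASURABILITY of the restricted ∕ nested pieces

Audit cell `pub-balaban`, SUBSTRATE cell seat p4; typer MAP v0.2 §4 p4 (2): «… non-negativity, measurability, and the reading “piece ≠ 0 ⇒
V small on Ω_k∖Z” (`lfPiece_chiPlaq` iterated)».  Same namespace as parts 1–2 (`lfPieceOn`, `Stage`, `admissible`, `nestedPiece`,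
`chiPlaq`, `largeSet`, `lfPieceOn_chiPlaq` imported BY NAME).

WHAT THIS FILE PROVIDES (all `[folklore]`):
 * §1 `mem_admissible_cons` (a history `Z :: outs` is admissible iff `Z ⊆ tests hist` and `outs` is admissible after `hist ++ [Z]`);
 * §2 SHARP STAGES `sharpStage (t, δ) = ⟨t, chiPlaq δ⟩`, the OBSERVED HISTORY `observed specs hist V` (`Z₀ = t₀ hist ∩ largeSet δ₀ V`,
   then recursively), `observed_mem_admissible`, and **`nestedPiece_sharp`**: for an admissible history,
   `nestedPiece (specs.map sharpStage) hist ρ outs V = if outs = observed specs hist V then ρ V else 0` — so a non-zero piece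
   FORCES `outs = observed …` (`eq_observed_of_nestedPiece_ne_zero`), and on the observed history the field is SMALL (`dist1 < δ`)
   at every tested plaquette off the recorded set (`dist1_lt_of_observed_head`, stage by stage via `observed_cons`);
 * §3 measurability: `measurable_lfPieceOn`, **`measurable_nestedPiece`** (all stage weights measurable, `ρ` measurable), and the
   sharp case from a measurable `dist1` (`measurable_nestedPiece_sharp`).
HONEST FRAMING (T4-DAG p. 1).  Finite bookkeeping at one lattice level; no estimate; the geometry of the test sets and the 𝐑-operation
are elsewhere (S-GEOM ∕ S-R).  NOT an estimate of any NE row; spine 0/9 unchanged; NOT infinite volume, NOT a mass gap, NOT Clay.  HONEST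
DEPENDENCY: continuum YM on T⁴ ⇐ BetaPertH ∧ nine spine estimates (0/9 proved); BetaPertH ⇐ (D1) ∧ (D4) ∧ CAP+tail; G-an2-4 gates asym, D1
and NE2/3/4.  No `sorry`.
-/

noncomputable section

open scoped BigOperators
open _root_.MeasureTheory

namespace Summit.QuantumFields.BalabanUV.T4Continuum.SubstrateLargeField

open Literature.MathematicalPhysics.QuantumFieldTheory.Balaban1983to89

variable {P : Params} {j : ℕ} {G : Type*} [DecidableEq (Plaq P j)]

/-! ## §1 Admissible histories, one stage at a time -/

/-- A history `Z :: outs` is admissible for `s :: rest` after `hist` iff `Z ⊆ s.tests hist` and `outs` is admissible for `rest`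
after `hist ++ [Z]`. [folklore] -/
theorem mem_admissible_cons {s : Stage P j G} {rest : List (Stage P j G)} {hist : List (Finset (Plaq P j))}
    {Z : Finset (Plaq P j)} {outs : List (Finset (Plaq P j))} :
    Z :: outs ∈ admissible (s :: rest) hist ↔ Z ⊆ s.tests hist ∧ outs ∈ admissible rest (hist ++ [Z]) := by
  rw [admissible_cons, Finset.mem_biUnion]
  constructor
  · rintro ⟨Z', hZ', hmem⟩
    obtain ⟨outs', houts', heq⟩ := Finset.mem_image.mp hmem
    obtain ⟨rfl, rfl⟩ := List.cons_eq_cons.mp heq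
    exact ⟨Finset.mem_powerset.mp hZ', houts'⟩
  · rintro ⟨hZ, houts⟩
    exact ⟨Z, Finset.mem_powerset.mpr hZ, Finset.mem_image.mpr ⟨outs, houts, rfl⟩⟩

/-- The empty history is admissible only for the empty stage list… precisely: `[] ∉ admissible (s :: rest) hist`. [folklore] -/
theorem nil_not_mem_admissible_cons (s : Stage P j G) (rest : List (Stage P j G)) (hist : List (Finset (Plaq P j))) :
    ([] : List (Finset (Plaq P j))) ∉ admissible (s :: rest) hist := by
  rw [admissible_cons, Finset.mem_biUnion]
  rintro ⟨Z, -, hmem⟩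
  obtain ⟨outs, -, heq⟩ := Finset.mem_image.mp hmem
  exact List.cons_ne_nil _ _ heq

/-! ## §2 Sharp stages: the observed history is the only one with a non-zero piece -/

section Sharp
variable [GaugeGroup G]

/-- A SHARP stage from a test-set function and a threshold: weights `chiPlaq δ`. [folklore] -/
def sharpStage (td : (List (Finset (Plaq P j)) → Finset (Plaq P j)) × ℝ) : Stage P j G := ⟨td.1, chiPlaq td.2⟩

omit [DecidableEq (Plaq P j)] in
/-- `sharpStage` unfolded. [folklore] -/
@[simp] theorem sharpStage_tests (td : (List (Finset (Plaq P j)) → Finset (Plaq P j)) × ℝ) :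
    (sharpStage (G := G) td).tests = td.1 := rfl

omit [DecidableEq (Plaq P j)] in
/-- `sharpStage` unfolded. [folklore] -/
@[simp] theorem sharpStage_wt (td : (List (Finset (Plaq P j)) → Finset (Plaq P j)) × ℝ) :
    (sharpStage (G := G) td).wt = chiPlaq td.2 := rfl

/-- THE OBSERVED HISTORY of a configuration `V` through sharp stages: at each stage the recorded large-field set is the set of
tested plaquettes that are large (`t hist ∩ largeSet δ V`), and the next stage is read after appending it. [folklore] -/
def observed : List ((List (Finset (Plaq P j)) → Finset (Plaq P j)) × ℝ) → List (Finset (Plaq P j)) →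
    GaugeField P j G → List (Finset (Plaq P j))
  | [], _, _ => []
  | td :: rest, hist, V => (td.1 hist ∩ largeSet td.2 V) :: observed rest (hist ++ [td.1 hist ∩ largeSet td.2 V]) V

/-- `observed` unfolded at the first stage. [folklore] -/
@[simp] theorem observed_cons (td : (List (Finset (Plaq P j)) → Finset (Plaq P j)) × ℝ)
    (rest : List ((List (Finset (Plaq P j)) → Finset (Plaq P j)) × ℝ)) (hist : List (Finset (Plaq P j))) (V : GaugeField P j G) :
    observed (td :: rest) hist V = (td.1 hist ∩ largeSet td.2 V) :: observed rest (hist ++ [td.1 hist ∩ largeSet td.2 V]) V := rfl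

/-- `observed [] = []`. [folklore] -/
@[simp] theorem observed_nil (hist : List (Finset (Plaq P j))) (V : GaugeField P j G) : observed [] hist V = [] := rfl

/-- The observed history is admissible. [folklore] -/
theorem observed_mem_admissible : ∀ (specs : List ((List (Finset (Plaq P j)) → Finset (Plaq P j)) × ℝ))
    (hist : List (Finset (Plaq P j))) (V : GaugeField P j G),
    observed specs hist V ∈ admissible (specs.map (sharpStage (G := G))) hist
  | [], hist, V => by simp
  | td :: rest, hist, V => by
    rw [List.map_cons, observed_cons, mem_admissible_cons]
    exact ⟨Finset.inter_subset_left, observed_mem_admissible rest _ V⟩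

/-- **THE SHARP NESTED DECOMPOSITION, READ EXACTLY**: for an admissible history `outs`, the piece is `ρ V` if `outs` IS the
observed history of `V`, and `0` otherwise. [folklore] -/
theorem nestedPiece_sharp : ∀ (specs : List ((List (Finset (Plaq P j)) → Finset (Plaq P j)) × ℝ))
    (hist : List (Finset (Plaq P j))) (ρ : Density P j G) {outs : List (Finset (Plaq P j))}
    (_ : outs ∈ admissible (specs.map (sharpStage (G := G))) hist) (V : GaugeField P j G),
    nestedPiece (specs.map (sharpStage (G := G))) hist ρ outs V = if outs = observed specs hist V then ρ V else 0
  | [], hist, ρ, outs, houts, V => by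
    simp only [List.map_nil, admissible_nil, Finset.mem_singleton] at houts
    subst houts
    simp
  | td :: rest, hist, ρ, [], houts, V => (nil_not_mem_admissible_cons _ _ _ houts).elim
  | td :: rest, hist, ρ, Z :: outs, houts, V => by
    rw [List.map_cons] at houts
    obtain ⟨hZ, houts'⟩ := mem_admissible_cons.mp houts
    rw [List.map_cons, nestedPiece_cons_cons, nestedPiece_sharp rest _ _ houts' V, observed_cons]
    simp only [sharpStage_tests, sharpStage_wt] at hZ ⊢
    rw [lfPieceOn_chiPlaq _ _ ρ hZ V]
    by_cases hZeq : Z = td.1 hist ∩ largeSet td.2 V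
    · by_cases houtseq : outs = observed rest (hist ++ [Z]) V
      · have hc : Z :: outs =
            (td.1 hist ∩ largeSet td.2 V) :: observed rest (hist ++ [td.1 hist ∩ largeSet td.2 V]) V := by
          rw [houtseq, hZeq]
        rw [if_pos houtseq, if_pos hZeq, if_pos hc]
      · have hc : ¬ (Z :: outs =
            (td.1 hist ∩ largeSet td.2 V) :: observed rest (hist ++ [td.1 hist ∩ largeSet td.2 V]) V) := by
          intro h
          apply houtseq
          rw [hZeq]
          exact (List.cons_eq_cons.mp h).2
        rw [if_neg houtseq, if_neg hc]
    · have hc : ¬ (Z :: outs =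
          (td.1 hist ∩ largeSet td.2 V) :: observed rest (hist ++ [td.1 hist ∩ largeSet td.2 V]) V) :=
        fun h => hZeq (List.cons_eq_cons.mp h).1
      rw [if_neg hc, if_neg hZeq, ite_self]

/-- Hence a NON-ZERO piece forces the history to be the observed one. [folklore] -/
theorem eq_observed_of_nestedPiece_ne_zero (specs : List ((List (Finset (Plaq P j)) → Finset (Plaq P j)) × ℝ))
    (hist : List (Finset (Plaq P j))) (ρ : Density P j G) {outs : List (Finset (Plaq P j))}
    (houts : outs ∈ admissible (specs.map (sharpStage (G := G))) hist) {V : GaugeField P j G}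
    (hne : nestedPiece (specs.map (sharpStage (G := G))) hist ρ outs V ≠ 0) : outs = observed specs hist V := by
  by_contra h
  rw [nestedPiece_sharp specs hist ρ houts V, if_neg h] at hne
  exact hne rfl

/-- … and on the observed history the piece is the density. [folklore] -/
theorem nestedPiece_observed (specs : List ((List (Finset (Plaq P j)) → Finset (Plaq P j)) × ℝ))
    (hist : List (Finset (Plaq P j))) (ρ : Density P j G) (V : GaugeField P j G) :
    nestedPiece (specs.map (sharpStage (G := G))) hist ρ (observed specs hist V) V = ρ V := by
  rw [nestedPiece_sharp specs hist ρ (observed_mem_admissible specs hist V) V, if_pos rfl]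

/-- **SMALLNESS OFF THE RECORDED SET** (first stage; later stages by `observed_cons`): a tested plaquette NOT in the recorded
large-field set `(observed …).head` is small, `dist1 (V(∂p)) < δ`; one IN it is large. [folklore] -/
theorem dist1_lt_of_observed_head (td : (List (Finset (Plaq P j)) → Finset (Plaq P j)) × ℝ)
    (rest : List ((List (Finset (Plaq P j)) → Finset (Plaq P j)) × ℝ)) (hist : List (Finset (Plaq P j))) (V : GaugeField P j G)
    {p : Plaq P j} (hp : p ∈ td.1 hist) :
    (p ∉ (observed (td :: rest) hist V).head (by simp) ↔ dist1 (GaugeField.plaqHol V p) < td.2) := by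
  simp only [observed_cons, List.head_cons, Finset.mem_inter, mem_largeSet, not_and, not_le]
  exact ⟨fun h => h hp, fun h _ => h⟩

end Sharp

/-! ## §3 Measurability of the restricted and nested pieces -/

section Measurability
variable [MeasurableSpace G]

/-- The restricted pieces are measurable for measurable weights and density. [folklore] -/
theorem measurable_lfPieceOn (S : Finset (Plaq P j)) {χ : Plaq P j → GaugeField P j G → ℝ} {ρ : Density P j G}
    (hχ : ∀ p, Measurable (χ p)) (hρ : Measurable ρ) (Z : Finset (Plaq P j)) : Measurable (lfPieceOn S χ ρ Z) := by
  unfold lfPieceOn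
  refine (hρ.mul (Finset.measurable_prod _ fun p _ => ?_)).mul (Finset.measurable_prod _ fun p _ => hχ p)
  exact measurable_const.sub (hχ p)

/-- **The nested pieces are measurable** when every stage's weights are and `ρ` is. [folklore] -/
theorem measurable_nestedPiece : ∀ (stages : List (Stage P j G)) (hist : List (Finset (Plaq P j))) {ρ : Density P j G}
    (outs : List (Finset (Plaq P j))), (∀ s ∈ stages, ∀ p, Measurable (s.wt p)) → Measurable ρ →
    Measurable (nestedPiece stages hist ρ outs)
  | [], hist, ρ, outs, _, hρ => by simpa using hρ
  | s :: rest, hist, ρ, [], _, hρ => hρ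
  | s :: rest, hist, ρ, Z :: outs, hwt, hρ => by
    rw [nestedPiece_cons_cons]
    exact measurable_nestedPiece rest (hist ++ [Z]) outs (fun s' hs' => hwt s' (List.mem_cons_of_mem _ hs'))
      (measurable_lfPieceOn _ (hwt s (List.mem_cons_self)) hρ Z)

/-- The sharp nested pieces are measurable for a measurable density and a measurable `dist1`. [folklore] -/
theorem measurable_nestedPiece_sharp [GaugeGroup G] [MeasurableMul₂ G] [MeasurableInv G] (hd : Measurable (dist1 : G → ℝ))
    (specs : List ((List (Finset (Plaq P j)) → Finset (Plaq P j)) × ℝ)) (hist : List (Finset (Plaq P j))) {ρ : Density P j G}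
    (hρ : Measurable ρ) (outs : List (Finset (Plaq P j))) :
    Measurable (nestedPiece (specs.map (sharpStage (G := G))) hist ρ outs) := by
  refine measurable_nestedPiece _ hist outs (fun s hs p => ?_) hρ
  obtain ⟨td, -, rfl⟩ := List.mem_map.mp hs
  exact measurable_chiPlaq hd td.2 p

end Measurability

end Summit.QuantumFields.BalabanUV.T4Continuum.SubstrateLargeField
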